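import Literature.AlgebraicGeometry.Frobenioids.ArchimedeanCircleGeometry
import Literature.AlgebraicGeometry.Frobenioids.CircleOpensProofs2
import Literature.AlgebraicGeometry.Frobenioids.ArchimedeanAutActionWitness
import Literature.AlgebraicGeometry.Frobenioids.ArchimedeanDivisorMaximality
import Literature.AlgebraicGeometry.Frobenioids.ArchimedeanRegionCalculus
import HarnessLib

/-!
# Frobenioids II, §3: the conjugation rotation of an angular region (Lemma 3.2 (ii) on `O_ℂ^× ⊆ ℂ^×`)
# and twisted angular regions — `C₀`-level input for the "ample" clauses of Theorem 3.6 (i)/(ii)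

Mochizuki, *The geometry of Frobenioids II*, Kyushu J. Math. **62** (2008) 401–460, §3: Lemma 3.2 (ii)
p. 25 ("There exists a `w ∈ S¹` such that the translated open subset `w · A` satisfies
`φ_{-1}(w · A) = w · A` [i.e., `w · A` is invariant with respect to complex conjugation]"), Definition 3.1
(iv) p. 24 (`(V_K, A_K)|_L`), and the proof of Theorem 3.6 (i) p. 38: "By [the earlier portion of] Lemma
3.2, (ii), it is immediate from the construction of `C^Λ` that `C^Λ` is of `Aut`-ample, `Aut^sub`-ample,
and `End`-ample type" [cite: MochizukiFrdII2008, Lem 3.2 (ii) p.25].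

Contents (all PROVED): every endomorphism of `D₀` is an involution; in a commuting square of `D₀` the
two endomorphisms have the same Galois twist unless the target is real; Lemma 3.2 (ii), first sentence,
transported from Mathlib's `Circle` (abc-iut-L1-t7's `CircleOpens.ItemII_translate_holds`) to
abc-iut-L1-t4's `normOneSubgroup ℂ` (polar calculus from `ArchimedeanRegionCalculus.lean` /
`AngularRegionTensor.lean`); for an angular region `A` of `ℂ^×` a *conjugation rotation*
`c(A) ∈ O_ℂ^×` with `conj(A) = c(A) · A`; the scalars `twistScalar A σ ∈ {1, c(A)}` of the canonical
endomorphisms over `Gal(ℂ/ℝ)` and their cocycle identity; the twisted region `A|_σ` (`B ↦ B⁻¹ = conj(B)`).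
Used by `ArchimedeanTwistLift.lean` / `ArchimedeanAmpleness.lean` (seat abc-iut-L1-t9).
No statement of the paper is strengthened.
-/

namespace Literature.AlgebraicGeometry.Frobenioids

open CategoryTheory
open scoped Pointwise

noncomputable section

namespace ArchFrd

/-! ### `D₀`: endomorphisms are involutions; twists in a commuting square -/

namespace D0

/-- Every endomorphism of an object of `D₀` is an involution (`Gal(ℂ/ℝ) ≅ ℤ/2ℤ`, `End(Spec ℝ) = {id}`).
[cite: MochizukiFrdII2008, Def 3.1 (i) p.23] -/
theorem endo_comp_self {K : D0} (g : K ⟶ K) : g ≫ g = 𝟙 K := by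
  cases g with
  | idReal => rfl
  | gal σ =>
    change Hom.gal (xor σ σ) = Hom.gal false
    rw [Bool.xor_self]

/-- Every endomorphism of `D₀` is an isomorphism. [cite: MochizukiFrdII2008, Def 3.1 (i) p.23] -/
theorem isIso_endo {K : D0} (g : K ⟶ K) : IsIso g :=
  ⟨⟨g, endo_comp_self g, endo_comp_self g⟩⟩

/-- The inverse of an automorphism of `D₀` is the automorphism itself. [cite: MochizukiFrdII2008, Def 3.1 (i) p.23] -/
theorem iso_inv_eq_hom {K : D0} (g : K ≅ K) : g.inv = g.hom := by
  have h : g.hom ≫ g.hom = 𝟙 K := endo_comp_self g.hom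
  calc g.inv = g.inv ≫ (g.hom ≫ g.hom) := by rw [h, Category.comp_id]
    _ = g.hom := by rw [Iso.inv_hom_id_assoc]

/-- In a commuting square `g' ≫ b = b ≫ g` of `D₀` (`b : Spec L → Spec K`, `g`, `g'` endomorphisms) the
two endomorphisms have the same Galois twist — unless `K` is real (where `g = id`).
[cite: MochizukiFrdII2008, Def 3.1 (i) p.23] -/
theorem twists_eq_or_eq_real {L K : D0} (b : L ⟶ K) (g : K ⟶ K) (g' : L ⟶ L)
    (h : g' ≫ b = b ≫ g) : Hom.twists g' = Hom.twists g ∨ K = real := by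
  cases b with
  | idReal => exact Or.inr rfl
  | toReal => exact Or.inr rfl
  | gal τ =>
    left
    cases g with
    | gal σ =>
      cases g' with
      | gal σ' =>
        change Hom.gal (xor σ' τ) = Hom.gal (xor τ σ) at h
        have hx : xor σ' τ = xor τ σ := Hom.gal.inj h
        rw [twists_gal, twists_gal]
        revert hx
        cases σ <;> cases σ' <;> cases τ <;> simp

/-- An endomorphism of `Spec ℝ` does not twist. [cite: MochizukiFrdII2008, Def 3.1 (i) p.23] -/
theorem twists_endo_real (g : real ⟶ real) : Hom.twists g = false := by
  rw [hom_real_real_eq_id g, twists_id]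

/-- An endomorphism of a real object does not twist. [cite: MochizukiFrdII2008, Def 3.1 (i) p.23] -/
theorem twists_eq_false_of_eq_real {K : D0} (hK : K = real) (g : K ⟶ K) : Hom.twists g = false := by
  subst hK
  exact twists_endo_real g

end D0

/-! ### Complex conjugation on `ℂ^×` versus inversion on `O_ℂ^× = S¹` -/

/-- On `O_ℂ^×`, complex conjugation is inversion. [cite: MochizukiFrdII2008, Def 3.1 (ii) p.23] -/
theorem star_coe_normOne (z : ↥(normOneSubgroup ℂ)) :
    star ((z : ℂˣ)) = ((z⁻¹ : ↥(normOneSubgroup ℂ)) : ℂˣ) := by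
  apply Units.ext
  rw [Units.coe_star, Subgroup.coe_inv, Units.val_inv_eq_inv_val, Complex.star_def]
  exact (Complex.inv_eq_conj ((mem_normOneSubgroup_iff ℂ _).1 z.2)).symm

/-- `c̄ · c = 1` for `c ∈ O_ℂ^×`. [cite: MochizukiFrdII2008, Def 3.1 (ii) p.23] -/
theorem star_coe_mul_self (z : ↥(normOneSubgroup ℂ)) : star ((z : ℂˣ)) * (z : ℂˣ) = 1 := by
  rw [star_coe_normOne, Subgroup.coe_inv, inv_mul_cancel]

/-- `|z · u| = |u|` for `z ∈ O_ℂ^×`. [cite: MochizukiFrdII2008, Def 3.1 (ii) p.24] -/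
theorem absHom_normOne_mul (z : ↥(normOneSubgroup ℂ)) (u : ℂˣ) : absHom ℂ ((z : ℂˣ) * u) = absHom ℂ u := by
  have hz : absHom ℂ (z : ℂˣ) = 1 := by rw [← MonoidHom.mem_ker, ker_absHom]; exact z.2
  rw [map_mul, hz, one_mul]

/-! ### Lemma 3.2 (ii), first sentence, on `O_ℂ^×`; the conjugation rotation of an angular region -/

/-- **Lemma 3.2 (ii)**, first sentence, transported from Mathlib's `Circle` (abc-iut-L1-t7's
`CircleOpens.ItemII_translate_holds`) to `O_ℂ^× ⊆ ℂ^×`: for a connected open `B ⊆ O_ℂ^×` there is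
`w ∈ O_ℂ^×` with `(w · B)⁻¹ = w · B`. [cite: MochizukiFrdII2008, Lem 3.2 (ii) p.25] -/
theorem exists_inv_smul_set_eq {B : Set ↥(normOneSubgroup ℂ)} (hB : IsConnected B) (hBo : IsOpen B) :
    ∃ w : ↥(normOneSubgroup ℂ), (w • B)⁻¹ = w • B := by
  obtain ⟨e, H, hHe, -⟩ := exists_unitCircleEquiv
  have hE : IsConnected (H ⁻¹' B) := H.isConnected_preimage.2 hB
  have hEo : IsOpen (H ⁻¹' B) := H.isOpen_preimage.2 hBo
  obtain ⟨w₀, hw₀⟩ := CircleOpens.ItemII_translate_holds (H ⁻¹' B) hE hEo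
  have hphi : CircleOpens.phi (-1) = (fun z : Circle => z⁻¹) := funext (CircleOpens.phi_neg_one)
  rw [hphi, Set.image_inv_eq_inv] at hw₀
  -- transport along the group isomorphism `e` (= `H` pointwise)
  have hB' : (e : Circle → ↥(normOneSubgroup ℂ)) '' (H ⁻¹' B) = B := by
    ext z
    constructor
    · rintro ⟨y, hy, rfl⟩
      rw [← hHe]; exact hy
    · intro hz
      exact ⟨H.symm z, by simpa using hz, by rw [← hHe, H.apply_symm_apply]⟩
  refine ⟨e w₀, ?_⟩
  rw [← hB', ← Set.image_smul_distrib, ← Set.image_inv e, hw₀]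

/-- For an angular region `A` of `ℂ^×`: a rotation `c ∈ O_ℂ^×` with `B⁻¹ = c · B` for its angular part
`B` (from Lemma 3.2 (ii): `(w · B)⁻¹ = w · B` gives `c = w²`). [cite: MochizukiFrdII2008, Lem 3.2 (ii) p.25] -/
theorem AngularRegion.exists_inv_dir_eq_smul (A : AngularRegion ℂ) :
    ∃ c : ↥(normOneSubgroup ℂ), A.dir⁻¹ = c • A.dir := by
  obtain ⟨w, hw⟩ := exists_inv_smul_set_eq A.isConnected_dir A.isOpen_dir
  refine ⟨w * w, Set.ext fun z => ?_⟩
  rw [Set.mem_inv, mul_smul, Set.mem_smul_set_iff_inv_smul_mem, Set.mem_smul_set_iff_inv_smul_mem]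
  have key : z⁻¹ ∈ A.dir ↔ w • z⁻¹ ∈ (w • A.dir)⁻¹ := by
    rw [hw, Set.smul_mem_smul_set_iff]
  rw [key, Set.mem_inv, smul_eq_mul, smul_eq_mul, smul_eq_mul, mul_inv, inv_inv,
    Set.mem_smul_set_iff_inv_smul_mem, smul_eq_mul]

/-- The conjugation rotation `c(A) ∈ O_ℂ^×` of an angular region: `B⁻¹ = c(A) · B` (a choice; unique
unless `A` is isotropic). [cite: MochizukiFrdII2008, Lem 3.2 (ii) p.25] -/
def AngularRegion.conjRot (A : AngularRegion ℂ) : ↥(normOneSubgroup ℂ) :=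
  Classical.choose A.exists_inv_dir_eq_smul

/-- Defining property of the conjugation rotation. [cite: MochizukiFrdII2008, Lem 3.2 (ii) p.25] -/
theorem AngularRegion.inv_dir_eq_conjRot_smul (A : AngularRegion ℂ) : A.dir⁻¹ = A.conjRot • A.dir :=
  Classical.choose_spec A.exists_inv_dir_eq_smul

/-- Rotating the carrier by `c ∈ O_ℂ^×` rotates the angular part: `u ∈ c · A` iff
`unitPart(u) ∈ c · B` and `|u| ≤ tip`. [cite: MochizukiFrdII2008, Def 3.1 (iii) p.24] -/
theorem AngularRegion.mem_smul_carrier_iff (A : AngularRegion ℂ) (c : ↥(normOneSubgroup ℂ)) (u : ℂˣ) :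
    u ∈ ((c : ℂˣ)) • A.carrier ↔ unitPart ℂ u ∈ c • A.dir ∧ absHom ℂ u ≤ A.tip := by
  rw [Set.mem_smul_set_iff_inv_smul_mem, Set.mem_smul_set_iff_inv_smul_mem, smul_eq_mul, smul_eq_mul,
    A.mem_carrier_iff, ← Subgroup.coe_inv, unitPart_mul, unitPart_normOne_coe, absHom_normOne_mul]

/-- `conj(A) = c(A) · A` inside `ℂ^×` (complex conjugation of the carrier is the rotation by the
conjugation rotation). [cite: MochizukiFrdII2008, Lem 3.2 (ii) p.25] -/
theorem AngularRegion.image_star_carrier (A : AngularRegion ℂ) :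
    D0.galAct true '' A.carrier = ((A.conjRot : ℂˣ)) • A.carrier := by
  ext u
  rw [A.mem_smul_carrier_iff, ← A.inv_dir_eq_conjRot_smul, Set.mem_inv]
  constructor
  · rintro ⟨v, hv, rfl⟩
    rw [unitPart_galAct_true, inv_inv, C0.absHom_galAct]
    exact hv
  · rintro ⟨h1, h2⟩
    refine ⟨D0.galAct true u, ⟨?_, ?_⟩, D0.galAct_galAct _ _⟩
    · rw [unitPart_galAct_true]; exact h1
    · rw [C0.absHom_galAct]; exact h2

/-! ### The scalar of the canonical endomorphism over a twist -/

/-- The scalar of the canonical endomorphism of an object with angular region `A` over a base arrow of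
twist `σ`: `1` over the identity, the conjugation rotation `c(A)` over complex conjugation.
[cite: MochizukiFrdII2008, Thm 3.6 (i) p.36] -/
def AngularRegion.twistScalar (A : AngularRegion ℂ) : Bool → ℂˣ
  | false => 1
  | true => (A.conjRot : ℂˣ)

/-- `twistScalar σ · A = σ(A)`. [cite: MochizukiFrdII2008, Lem 3.2 (ii) p.25] -/
theorem AngularRegion.twistScalar_smul_carrier (A : AngularRegion ℂ) (σ : Bool) :
    A.twistScalar σ • A.carrier = D0.galAct σ '' A.carrier := by
  cases σ with
  | false => rw [D0.image_galAct_false]; exact one_smul _ _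
  | true => exact A.image_star_carrier.symm

/-- The twist scalars have norm `1`. [cite: MochizukiFrdII2008, Def 3.1 (ii) p.23] -/
theorem AngularRegion.norm_twistScalar (A : AngularRegion ℂ) (σ : Bool) : ‖(A.twistScalar σ : ℂ)‖ = 1 := by
  cases σ with
  | false => simp [AngularRegion.twistScalar]
  | true => exact (mem_normOneSubgroup_iff ℂ _).1 A.conjRot.2

/-- Multiplicativity of the twist scalars along `Gal(ℂ/ℝ) ≅ ℤ/2ℤ`: `σ(c_τ) · c_σ = c_{σ+τ}` (the case
`σ = τ =` conjugation is `c̄ · c = 1`). [cite: MochizukiFrdII2008, Def 3.1 (i) p.23] -/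
theorem AngularRegion.galAct_twistScalar_mul (A : AngularRegion ℂ) (σ τ : Bool) :
    D0.galAct σ (A.twistScalar τ) * A.twistScalar σ = A.twistScalar (xor σ τ) := by
  cases σ with
  | false => cases τ <;> simp [AngularRegion.twistScalar]
  | true =>
    cases τ with
    | false => simp [AngularRegion.twistScalar]
    | true =>
      change star ((A.conjRot : ℂˣ)) * (A.conjRot : ℂˣ) = 1
      exact star_coe_mul_self _

/-- The twist scalar over an endomorphism `g` of `Spec K` is a scalar of `K` (for real `K`, `g = id` and the
scalar is `1`). [cite: MochizukiFrdII2008, Ex 3.3 (i) p.27] -/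
theorem AngularRegion.twistScalar_mem_scalars (A : AngularRegion ℂ) {K : D0} (g : K ⟶ K) :
    A.twistScalar (D0.Hom.twists g) ∈ D0.scalars K := by
  cases g with
  | idReal => exact one_mem _
  | gal σ => simp

/-! ### Twisting an angular region by an element of `Gal(ℂ/ℝ)` -/

/-- The angular region `A_K|_b` read in `ℂ^×`: the angular part twisted by the Galois action of `b`
(`B` or `B⁻¹ = conj(B)`), the same tip (Def. 3.1 (iv)). [cite: MochizukiFrdII2008, Def 3.1 (iv) p.24] -/
def AngularRegion.twist (A : AngularRegion ℂ) :
    Bool → AngularRegion ℂ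
  | false => A
  | true =>
    { dir := A.dir⁻¹
      tip := A.tip
      isOpen_dir := isOpen_inv' A.isOpen_dir
      isConnected_inter := fun z => by
        haveI : ConnectedSpace ↥(normOneSubgroup ℂ) := connectedSpace_iff_univ.mpr isConnected_univ_normOne
        rw [PreconnectedSpace.connectedComponent_eq_univ, Set.inter_univ]
        exact isConnected_inv A.isConnected_dir }

/-- The carrier of the twisted region is the Galois image of the carrier.
[cite: MochizukiFrdII2008, Def 3.1 (iv) p.24] -/
theorem AngularRegion.carrier_twist (A : AngularRegion ℂ)
    (σ : Bool) : (A.twist σ).carrier = D0.galAct σ '' A.carrier := by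
  cases σ with
  | false => exact (D0.image_galAct_false _).symm
  | true =>
    ext u
    change unitPart ℂ u ∈ A.dir⁻¹ ∧ absHom ℂ u ≤ A.tip ↔ _
    rw [Set.mem_inv]
    constructor
    · rintro ⟨h1, h2⟩
      refine ⟨D0.galAct true u, ⟨?_, ?_⟩, D0.galAct_galAct _ _⟩
      · rw [unitPart_galAct_true]; exact h1
      · rw [C0.absHom_galAct]; exact h2
    · rintro ⟨v, hv, rfl⟩
      rw [unitPart_galAct_true, inv_inv, C0.absHom_galAct]
      exact hv

/-- Twisting preserves isotropy. [cite: MochizukiFrdII2008, Def 3.1 (iv) p.24] -/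
theorem AngularRegion.isIsotropic_twist {A : AngularRegion ℂ}
    (h : A.IsIsotropic) (σ : Bool) : (A.twist σ).IsIsotropic := by
  cases σ with
  | false => exact h
  | true => change A.dir⁻¹ = Set.univ; rw [show A.dir = Set.univ from h, Set.inv_univ]

/-- Twisting preserves the tip. [cite: MochizukiFrdII2008, Def 3.1 (iv) p.24] -/
@[simp] theorem AngularRegion.tip_twist (A : AngularRegion ℂ) (σ : Bool) : (A.twist σ).tip = A.tip := by
  cases σ <;> rfl

end ArchFrd

end

end Literature.AlgebraicGeometry.Frobenioids
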